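import Summits.NavierStokesRegularity.NavierStokesRegularity.Theorems.ExtremiserTransienceNearExtremalTransienceExtremiserLiouvilleConstantSpeedLerayCorrector
import Literature.Analysis.FluidPDE.VorticityCalculus
import Literature.Analysis.FluidPDE.BiotSavartCurlPair
import HarnessLib

/-!
# Crux `ExtremiserTransience.NearExtremalTransience` (stmt-NavierStokesRegularity-21883), line `extremiser_liouville`,
# stub K1b — the localised KKT inequality EXPANDED: main `θ`-weighted terms and explicit `∇θ`-cross terms

`--supports stmt-NavierStokesRegularity-21883` (helper).  Author: prover seat `ns-el-k1b` (g5).  Calculus layer on top of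
`…ConstantSpeedLerayCorrector.firstVariation_smul_ge_leray` (the record's §4, steps (i)–(iii)):

* pointwise: `curl_smul_eq_add_cross` (`curl(θV) = θω + ∇θ × V`), `fderiv_smul_apply_eq` (`D(θV)h = θDVh + (Dθh)V`),
  `fderiv_curl_smul_apply_eq` (`D(curl θV)h = (Dθh)ω + θDωh + (D∇θ h) × V + ∇θ × DVh`);
* the three first variations along `θV` split into `θ`-weighted main terms and compactly supported cross terms:
  `firstVar_enstrophy_smul` (`a₁(θV) = ∫θ‖ω‖² + ∫⟪ω, ∇θ × V⟫`), `firstVar_stretching_smul`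
  (`J₁(θV) = 3∫θ⟪ω,DVω⟫ + ∫[⟪∇θ×V, DVω⟫ + (Dθ ω)⟪ω,V⟫ + ⟪ω, DV(∇θ×V)⟫]`), `firstVar_palinstrophy_smul`
  (`c₁(θV) = ∫θ|Dω|²_F + ∫Σᵢ⟪∂ᵢω, (∂ᵢθ)ω + (∂ᵢ∇θ) × V + ∇θ × ∂ᵢV⟫`);
* **`localisedKKT_expanded`**: for the constant-speed residue `v` (`‖v‖ ≡ M = ‖c‖`), every `θ ∈ C^∞_c(ℝ³;[0,1])`,
  `A ≥ sup|div(θ(v−c))|`, `R > 0`: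
  `κ⋆²M²(W·Z_θ + Z·W_θ) ≤ 3S·S_θ + S·J_× − κ⋆²M²(W·A_× + Z·C_×) − S∫⟪ω, D∇π[θ(v−c)] ω⟫ + κ⋆²MZW·(AR + √(∫(div θ(v−c))²/(4πR)))`
  with `X_θ = ∫θ·(density of X)` — the record's inequality, now a theorem with every term explicit.

NEXT (analysis, for the following seat): choose `θ = g(ξ)χ_ρ(x_h)` on a jet segment and bound the cross terms by
`‖∇θ‖_∞, ‖D∇θ‖_∞` times local `L²` masses, the pressure-Hessian term by `…NewtonGradientBound` with `φ = ∂div(θV)`.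

WHAT THIS IS NOT: K1b is NOT proved; nothing here proves NS regularity. [folklore]
-/

noncomputable section

open Set Filter Topology MeasureTheory Metric Function Real
open scoped ENNReal NNReal Topology InnerProductSpace RealInnerProductSpace ContDiff
open Literature.Analysis.FluidPDE Literature.Analysis

namespace Summit.NavierStokesRegularity.NavierStokesRegularity.Theorems

-- the problem directory repeats the summit name (`NavierStokesRegularity/NavierStokesRegularity`)
set_option linter.dupNamespace false

namespace ExtremiserLiouville

open DepletionLadder.KStar

/-! ## Pointwise calculus of the truncated deviation `θ • V` -/

section Pointwise

variable {θ : EuclideanSpace ℝ (Fin 3) → ℝ} {V : EuclideanSpace ℝ (Fin 3) → EuclideanSpace ℝ (Fin 3)}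

/-- `curl(θV) = θ ω + ∇θ × V`. [folklore] -/
theorem curl_smul_eq_add_cross (hθ : ContDiff ℝ ∞ θ) (hV : ContDiff ℝ ∞ V) (x : EuclideanSpace ℝ (Fin 3)) :
    curl (fun y => θ y • V y) x = θ x • curl V x + cross (gradient θ x) (V x) := by
  rw [curl_smul ((hθ.differentiable (by simp)) x) ((hV.differentiable (by simp)) x), fderiv_eq_innerSL_gradient,
    curlCLM_smulRight_innerSL]

/-- `D(θV) h = θ DV h + (Dθ h) V`. [folklore] -/
theorem fderiv_smul_apply_eq (hθ : ContDiff ℝ ∞ θ) (hV : ContDiff ℝ ∞ V) (x h : EuclideanSpace ℝ (Fin 3)) :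
    fderiv ℝ (fun y => θ y • V y) x h = θ x • fderiv ℝ V x h + (fderiv ℝ θ x h) • V x := by
  rw [fderiv_fun_smul ((hθ.differentiable (by simp)) x) ((hV.differentiable (by simp)) x)]
  rfl

/-- `D(curl(θV)) h = (Dθ h) ω + θ Dω h + (D∇θ h) × V + ∇θ × (DV h)`. [folklore] -/
theorem fderiv_curl_smul_apply_eq (hθ : ContDiff ℝ ∞ θ) (hV : ContDiff ℝ ∞ V) (x h : EuclideanSpace ℝ (Fin 3)) :
    fderiv ℝ (curl (fun y => θ y • V y)) x h =
      (fderiv ℝ θ x h) • curl V x + θ x • fderiv ℝ (curl V) x h +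
        cross (fderiv ℝ (gradient θ) x h) (V x) + cross (gradient θ x) (fderiv ℝ V x h) := by
  have hcurl : curl (fun y => θ y • V y) = fun x => θ x • curl V x + cross (gradient θ x) (V x) :=
    funext (curl_smul_eq_add_cross hθ hV)
  have hθd : DifferentiableAt ℝ θ x := (hθ.differentiable (by simp)) x
  have hVd : DifferentiableAt ℝ V x := (hV.differentiable (by simp)) x
  have hωd : DifferentiableAt ℝ (curl V) x := ((contDiff_curl_top hV).differentiable (by simp)) x
  have hgd : DifferentiableAt ℝ (gradient θ) x := ((contDiff_gradient_top hθ).differentiable (by simp)) x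
  have h1 : HasFDerivAt (fun y => θ y • curl V y) (θ x • fderiv ℝ (curl V) x + (fderiv ℝ θ x).smulRight (curl V x)) x :=
    hθd.hasFDerivAt.smul hωd.hasFDerivAt
  have h2 := hasFDerivAt_cross hgd.hasFDerivAt hVd.hasFDerivAt
  have h12 : HasFDerivAt (fun y => θ y • curl V y + cross (gradient θ y) (V y))
      (θ x • fderiv ℝ (curl V) x + (fderiv ℝ θ x).smulRight (curl V x) +
        (crossCLM.precompR (EuclideanSpace ℝ (Fin 3)) (gradient θ x) (fderiv ℝ V x) +
          crossCLM.precompL (EuclideanSpace ℝ (Fin 3)) (fderiv ℝ (gradient θ) x) (V x))) x := h1.add h2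
  rw [hcurl, h12.fderiv]
  simp only [_root_.add_apply, FunLike.coe_smul, Pi.smul_apply, ContinuousLinearMap.smulRight_apply,
    ContinuousLinearMap.precompR_apply, ContinuousLinearMap.precompL_apply, ContinuousLinearMap.compL_apply,
    ContinuousLinearMap.coe_comp, Function.comp_apply, crossCLM_apply]
  abel

/-- `0 × w = 0`. [folklore] -/
private theorem cross_zero_left' (w : EuclideanSpace ℝ (Fin 3)) : cross 0 w = 0 := by
  rw [← crossCLM_apply, map_zero]; rfl

end Pointwise

/-! ## The expansion of the three first variations along `θV` -/

section Expansion

variable {v : EuclideanSpace ℝ (Fin 3) → EuclideanSpace ℝ (Fin 3)} {c : EuclideanSpace ℝ (Fin 3)} {θ : EuclideanSpace ℝ (Fin 3) → ℝ}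

/-- The cut-off cross terms vanish off the (compact) support of `∇θ` (private copy of a tree lemma). [folklore] -/
private theorem hasCompactSupport_gradient_aux (hθc : HasCompactSupport θ) : HasCompactSupport (gradient θ) := by
  have e : gradient θ = fun x => (InnerProductSpace.toDual ℝ (EuclideanSpace ℝ (Fin 3))).symm (fderiv ℝ θ x) := rfl
  rw [e]
  exact (hθc.fderiv (𝕜 := ℝ)).comp_left (map_zero _)

/-- **`a₁(θV) = ∫θ‖ω‖² + ∫⟪ω, ∇θ × V⟫`.** [folklore] -/
theorem firstVar_enstrophy_smul (hv : ContDiff ℝ ∞ v) (h1 : ∫⁻ x, ‖iteratedFDeriv ℝ 1 v x‖ₑ ^ 2 < ⊤)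
    (hθ : ContDiff ℝ ∞ θ) (hθc : HasCompactSupport θ) (hθ01 : ∀ x, 0 ≤ θ x ∧ θ x ≤ 1) (c : EuclideanSpace ℝ (Fin 3)) :
    (∫ x, ⟪curl v x, curl (fun y => θ y • (v y - c)) x⟫) =
      (∫ x, θ x * ‖curl v x‖ ^ 2) + ∫ x, ⟪curl v x, cross (gradient θ x) (v x - c)⟫ := by
  have hV : ContDiff ℝ ∞ (fun y => v y - c) := hv.sub contDiff_const
  have hcurlV : curl (fun y => v y - c) = curl v := curl_sub_const v c
  have hpt : ∀ x, ⟪curl v x, curl (fun y => θ y • (v y - c)) x⟫ =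
      θ x * ‖curl v x‖ ^ 2 + ⟪curl v x, cross (gradient θ x) (v x - c)⟫ := fun x => by
    rw [curl_smul_eq_add_cross hθ hV, hcurlV, inner_add_right, real_inner_smul_right, real_inner_self_eq_norm_sq]
  have iZ : Integrable (fun x => ‖curl v x‖ ^ 2) volume := (integrable_norm_curl_sq (hv.of_le (by norm_cast)) h1).1
  have iθZ : Integrable (fun x => θ x * ‖curl v x‖ ^ 2) volume := by
    refine iZ.mono' ((hθ.continuous.mul ((continuous_curl (hv.of_le (by norm_cast))).norm.pow 2)).aestronglyMeasurable)
      (Eventually.of_forall fun x => ?_)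
    rw [Real.norm_eq_abs, abs_mul, abs_of_nonneg (hθ01 x).1, abs_of_nonneg (sq_nonneg _)]
    exact mul_le_of_le_one_left (sq_nonneg _) (hθ01 x).2
  have icross : Integrable (fun x => ⟪curl v x, cross (gradient θ x) (v x - c)⟫) volume := by
    refine Continuous.integrable_of_hasCompactSupport ?_ ?_
    · exact (continuous_curl (hv.of_le (by norm_cast))).inner
        (crossCLM.continuous₂.comp₂ (contDiff_gradient_top hθ).continuous hV.continuous)
    · refine (hasCompactSupport_gradient_aux hθc).mono fun x hx => ?_
      contrapose! hx
      simp only [Function.mem_support, not_not] at hx ⊢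
      rw [hx, cross_zero_left', inner_zero_right]
  rw [integral_congr_ae (Eventually.of_forall hpt), integral_add iθZ icross]

/-- **`J₁(θV) = 3∫θ⟪ω, DV ω⟫ + (∇θ-cross terms)`.** [folklore] -/
theorem firstVar_stretching_smul (hv : ContDiff ℝ ∞ v) {B : ℝ} (hB : ∀ x, ‖fderiv ℝ v x‖ ≤ B)
    (h1 : ∫⁻ x, ‖iteratedFDeriv ℝ 1 v x‖ₑ ^ 2 < ⊤)
    (hθ : ContDiff ℝ ∞ θ) (hθc : HasCompactSupport θ) (hθ01 : ∀ x, 0 ≤ θ x ∧ θ x ≤ 1) (c : EuclideanSpace ℝ (Fin 3)) :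
    (∫ x, (⟪curl (fun y => θ y • (v y - c)) x, fderiv ℝ v x (curl v x)⟫ +
        ⟪curl v x, fderiv ℝ (fun y => θ y • (v y - c)) x (curl v x)⟫ + ⟪curl v x, fderiv ℝ v x (curl (fun y => θ y • (v y - c)) x)⟫)) =
      3 * (∫ x, θ x * ⟪curl v x, fderiv ℝ v x (curl v x)⟫) +
        ∫ x, (⟪cross (gradient θ x) (v x - c), fderiv ℝ v x (curl v x)⟫ +
          (fderiv ℝ θ x (curl v x)) * ⟪curl v x, v x - c⟫ + ⟪curl v x, fderiv ℝ v x (cross (gradient θ x) (v x - c))⟫) := by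
  have hV : ContDiff ℝ ∞ (fun y => v y - c) := hv.sub contDiff_const
  have hcurlV : curl (fun y => v y - c) = curl v := curl_sub_const v c
  have hDV : ∀ x, fderiv ℝ (fun y => v y - c) x = fderiv ℝ v x := fun x => by rw [fderiv_sub_const]
  have hpt : ∀ x, ⟪curl (fun y => θ y • (v y - c)) x, fderiv ℝ v x (curl v x)⟫ +
        ⟪curl v x, fderiv ℝ (fun y => θ y • (v y - c)) x (curl v x)⟫ + ⟪curl v x, fderiv ℝ v x (curl (fun y => θ y • (v y - c)) x)⟫ =
      3 * (θ x * ⟪curl v x, fderiv ℝ v x (curl v x)⟫) +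
        (⟪cross (gradient θ x) (v x - c), fderiv ℝ v x (curl v x)⟫ +
          (fderiv ℝ θ x (curl v x)) * ⟪curl v x, v x - c⟫ + ⟪curl v x, fderiv ℝ v x (cross (gradient θ x) (v x - c))⟫) := by
    intro x
    rw [curl_smul_eq_add_cross hθ hV, hcurlV, fderiv_smul_apply_eq hθ hV, hDV]
    simp only [inner_add_left, inner_add_right, map_add, map_smul, real_inner_smul_left, real_inner_smul_right]
    ring
  have cω : Continuous (curl v) := continuous_curl (hv.of_le (by norm_cast))
  have cDv : Continuous (fderiv ℝ v) := hv.continuous_fderiv (by simp)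
  have i0 := integrable_stretching hv hB h1
  have iθS : Integrable (fun x => θ x * ⟪curl v x, fderiv ℝ v x (curl v x)⟫) volume := by
    refine i0.norm.mono' ((hθ.continuous.mul (cω.inner (cDv.clm_apply cω))).aestronglyMeasurable) (Eventually.of_forall fun x => ?_)
    rw [Real.norm_eq_abs, abs_mul, abs_of_nonneg (hθ01 x).1, Real.norm_eq_abs]
    exact mul_le_of_le_one_left (abs_nonneg _) (hθ01 x).2
  have icross : Integrable (fun x => ⟪cross (gradient θ x) (v x - c), fderiv ℝ v x (curl v x)⟫ +
      (fderiv ℝ θ x (curl v x)) * ⟪curl v x, v x - c⟫ + ⟪curl v x, fderiv ℝ v x (cross (gradient θ x) (v x - c))⟫) volume := by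
    have hcr : Continuous fun x => cross (gradient θ x) (v x - c) :=
      crossCLM.continuous₂.comp₂ (contDiff_gradient_top hθ).continuous hV.continuous
    refine Continuous.integrable_of_hasCompactSupport ?_ ?_
    · exact ((hcr.inner (cDv.clm_apply cω)).add (((hθ.continuous_fderiv (by simp)).clm_apply cω).mul
        (cω.inner hV.continuous))).add (cω.inner (cDv.clm_apply hcr))
    · refine (hasCompactSupport_gradient_aux hθc).mono fun x hx => ?_
      contrapose! hx
      simp only [Function.mem_support, not_not] at hx ⊢
      have hD : fderiv ℝ θ x = 0 := by rw [fderiv_eq_innerSL_gradient, hx, map_zero]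
      simp only [hx, hD, cross_zero_left', _root_.zero_apply, map_zero, inner_zero_left, inner_zero_right, zero_mul, add_zero]
  rw [integral_congr_ae (Eventually.of_forall hpt), integral_add (iθS.const_mul 3) icross, integral_const_mul]

/-- **`c₁(θV) = ∫θ|Dω|²_F + (∇θ-, D∇θ-cross terms)`.** [folklore] -/
theorem firstVar_palinstrophy_smul (hv : ContDiff ℝ ∞ v) (h2 : ∫⁻ x, ‖iteratedFDeriv ℝ 2 v x‖ₑ ^ 2 < ⊤)
    (hθ : ContDiff ℝ ∞ θ) (hθc : HasCompactSupport θ) (hθ01 : ∀ x, 0 ≤ θ x ∧ θ x ≤ 1) (c : EuclideanSpace ℝ (Fin 3)) :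
    (∫ x, ∑ i, ⟪fderiv ℝ (curl v) x (EuclideanSpace.basisFun (Fin 3) ℝ i),
        fderiv ℝ (curl (fun y => θ y • (v y - c))) x (EuclideanSpace.basisFun (Fin 3) ℝ i)⟫) =
      (∫ x, θ x * frobeniusNormSq (fderiv ℝ (curl v) x)) +
        ∫ x, ∑ i, ⟪fderiv ℝ (curl v) x (EuclideanSpace.basisFun (Fin 3) ℝ i),
          (fderiv ℝ θ x (EuclideanSpace.basisFun (Fin 3) ℝ i)) • curl v x +
            cross (fderiv ℝ (gradient θ) x (EuclideanSpace.basisFun (Fin 3) ℝ i)) (v x - c) +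
            cross (gradient θ x) (fderiv ℝ v x (EuclideanSpace.basisFun (Fin 3) ℝ i))⟫ := by
  have hV : ContDiff ℝ ∞ (fun y => v y - c) := hv.sub contDiff_const
  have hcurlV : curl (fun y => v y - c) = curl v := curl_sub_const v c
  have hDV : ∀ x, fderiv ℝ (fun y => v y - c) x = fderiv ℝ v x := fun x => by rw [fderiv_sub_const]
  have hpt : ∀ x, (∑ i, ⟪fderiv ℝ (curl v) x (EuclideanSpace.basisFun (Fin 3) ℝ i),
        fderiv ℝ (curl (fun y => θ y • (v y - c))) x (EuclideanSpace.basisFun (Fin 3) ℝ i)⟫) =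
      θ x * frobeniusNormSq (fderiv ℝ (curl v) x) +
        ∑ i, ⟪fderiv ℝ (curl v) x (EuclideanSpace.basisFun (Fin 3) ℝ i),
          (fderiv ℝ θ x (EuclideanSpace.basisFun (Fin 3) ℝ i)) • curl v x +
            cross (fderiv ℝ (gradient θ) x (EuclideanSpace.basisFun (Fin 3) ℝ i)) (v x - c) +
            cross (gradient θ x) (fderiv ℝ v x (EuclideanSpace.basisFun (Fin 3) ℝ i))⟫ := by
    intro x
    rw [frobeniusNormSq_eq_sum (EuclideanSpace.basisFun (Fin 3) ℝ), Finset.mul_sum, ← Finset.sum_add_distrib]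
    refine Finset.sum_congr rfl fun i _ => ?_
    rw [fderiv_curl_smul_apply_eq hθ hV, hcurlV, hDV]
    simp only [inner_add_right, real_inner_smul_right, real_inner_self_eq_norm_sq]
    ring
  have hω1 : ContDiff ℝ 1 (curl v) := contDiff_curl (n := 1) (hv.of_le (by norm_cast))
  have cDω : Continuous (fderiv ℝ (curl v)) := hω1.continuous_fderiv one_ne_zero
  have iW : Integrable (fun x => frobeniusNormSq (fderiv ℝ (curl v) x)) volume :=
    (integrable_frobeniusNormSq_fderiv_curl (hv.of_le (by norm_cast)) h2).1
  have iθW : Integrable (fun x => θ x * frobeniusNormSq (fderiv ℝ (curl v) x)) volume := by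
    refine iW.mono' ((hθ.continuous.mul (continuous_frobeniusNormSq_fderiv hω1 one_ne_zero)).aestronglyMeasurable)
      (Eventually.of_forall fun x => ?_)
    rw [Real.norm_eq_abs, abs_mul, abs_of_nonneg (hθ01 x).1, abs_of_nonneg (frobeniusNormSq_nonneg _)]
    exact mul_le_of_le_one_left (frobeniusNormSq_nonneg _) (hθ01 x).2
  have icross : Integrable (fun x => ∑ i, ⟪fderiv ℝ (curl v) x (EuclideanSpace.basisFun (Fin 3) ℝ i),
      (fderiv ℝ θ x (EuclideanSpace.basisFun (Fin 3) ℝ i)) • curl v x +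
        cross (fderiv ℝ (gradient θ) x (EuclideanSpace.basisFun (Fin 3) ℝ i)) (v x - c) +
        cross (gradient θ x) (fderiv ℝ v x (EuclideanSpace.basisFun (Fin 3) ℝ i))⟫) volume := by
    have cω : Continuous (curl v) := continuous_curl (hv.of_le (by norm_cast))
    have cDv : Continuous (fderiv ℝ v) := hv.continuous_fderiv (by simp)
    have cg : Continuous (gradient θ) := (contDiff_gradient_top hθ).continuous
    have cDg : Continuous (fderiv ℝ (gradient θ)) := (contDiff_gradient_top hθ).continuous_fderiv (by simp)
    have cDθ : Continuous (fderiv ℝ θ) := hθ.continuous_fderiv (by simp)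
    refine Continuous.integrable_of_hasCompactSupport ?_ ?_
    · refine continuous_finsetSum _ fun i _ => (cDω.clm_apply continuous_const).inner ?_
      exact (((cDθ.clm_apply continuous_const).smul cω).add
        (crossCLM.continuous₂.comp₂ (cDg.clm_apply continuous_const) hV.continuous)).add
        (crossCLM.continuous₂.comp₂ cg (cDv.clm_apply continuous_const))
    · refine (hasCompactSupport_gradient_aux hθc).mono' fun x hx => ?_
      contrapose! hx
      simp only [Function.mem_support, not_not] at hx ⊢
      have hg : gradient θ x = 0 := image_eq_zero_of_notMem_tsupport hx
      have hDg : fderiv ℝ (gradient θ) x = 0 := fderiv_of_notMem_tsupport ℝ hx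
      have hD : fderiv ℝ θ x = 0 := by rw [fderiv_eq_innerSL_gradient, hg, map_zero]
      refine Finset.sum_eq_zero fun i _ => ?_
      simp only [hg, hDg, hD, cross_zero_left', _root_.zero_apply, zero_smul, zero_add, inner_zero_right]
  rw [integral_congr_ae (Eventually.of_forall hpt), integral_add iθW icross]

/-- **THE LOCALISED KKT INEQUALITY, EXPANDED.**  For a constant-speed extended extremiser `v` (`‖v‖ ≡ M = ‖c‖`, `V = v − c`),
every `θ ∈ C^∞_c(ℝ³;[0,1])`, every `A ≥ sup|div(θV)|` and `R > 0`, with `ω = curl v`, `p = π[θV]`: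
`κ⋆²M²(W·∫θ‖ω‖² + Z·∫θ|Dω|²_F) ≤ 3S·∫θ⟪ω,DVω⟫ + S·J_× − κ⋆²M²(W·A_× + Z·C_×) − S·∫⟪ω, D∇p ω⟫ + κ⋆²MZW(AR + √(∫(div θV)²/(4πR)))`,
where `A_×, J_×, C_×` are the explicit `∇θ`-cross integrals of `firstVar_{enstrophy,stretching,palinstrophy}_smul`: the deleted
region's share of enstrophy and palinstrophy is paid for by its share of stretching, up to cut-off cross terms, the pressure
Hessian and the corrector's sup-norm excess. [folklore] -/
theorem localisedKKT_expanded
    (hv : ContDiff ℝ ∞ v) (hdiv : VectorCalculus.IsDivFree v) {M B : ℝ} (hMpos : 0 < M)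
    (hM : ∀ x, ‖v x‖ = M) (hcM : ‖c‖ = M) (hB : ∀ x, ‖fderiv ℝ v x‖ ≤ B)
    (h1 : ∫⁻ x, ‖iteratedFDeriv ℝ 1 v x‖ₑ ^ 2 < ⊤) (h2 : ∫⁻ x, ‖iteratedFDeriv ℝ 2 v x‖ₑ ^ 2 < ⊤)
    (hatt : |∫ x, ⟪curl v x, fderiv ℝ v x (curl v x)⟫| = (sInf {κ : ℝ | (∀ (v : EuclideanSpace ℝ (Fin 3) → EuclideanSpace ℝ (Fin 3)) (M B : ℝ), ContDiff ℝ (⊤ : ℕ∞) v → Literature.Analysis.FluidPDE.VectorCalculus.IsDivFree v → (∀ x, ‖v x‖ ≤ M) → (∀ x, ‖fderiv ℝ v x‖ ≤ B) → (∫⁻ x, ‖iteratedFDeriv ℝ 0 v x‖ₑ ^ 2 < ⊤) → (∫⁻ x, ‖iteratedFDeriv ℝ 1 v x‖ₑ ^ 2 < ⊤) → (∫⁻ x, ‖iteratedFDeriv ℝ 2 v x‖ₑ ^ 2 < ⊤) → |∫ x, ⟪Literature.Analysis.FluidPDE.curl v x, fderiv ℝ v x (Literature.Analysis.FluidPDE.curl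 v x)⟫_ℝ| ≤ κ * M * Real.sqrt (∫ x, ‖Literature.Analysis.FluidPDE.curl v x‖ ^ 2) * Real.sqrt (∫ x, Literature.Analysis.FluidPDE.frobeniusNormSq (fderiv ℝ (Literature.Analysis.FluidPDE.curl v) x)))}) * M * Real.sqrt (∫ x, ‖curl v x‖ ^ 2) * Real.sqrt (∫ x, frobeniusNormSq (fderiv ℝ (curl v) x)))
    (hθ : ContDiff ℝ ∞ θ) (hθc : HasCompactSupport θ) (hθ01 : ∀ x, 0 ≤ θ x ∧ θ x ≤ 1)
    {A : ℝ} (hA : ∀ x, |VectorCalculus.divergence (fun y => θ y • (v y - c)) x| ≤ A) {R : ℝ} (hR : 0 < R) :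
    (sInf {κ : ℝ | (∀ (v : EuclideanSpace ℝ (Fin 3) → EuclideanSpace ℝ (Fin 3)) (M B : ℝ), ContDiff ℝ (⊤ : ℕ∞) v → Literature.Analysis.FluidPDE.VectorCalculus.IsDivFree v → (∀ x, ‖v x‖ ≤ M) → (∀ x, ‖fderiv ℝ v x‖ ≤ B) → (∫⁻ x, ‖iteratedFDeriv ℝ 0 v x‖ₑ ^ 2 < ⊤) → (∫⁻ x, ‖iteratedFDeriv ℝ 1 v x‖ₑ ^ 2 < ⊤) → (∫⁻ x, ‖iteratedFDeriv ℝ 2 v x‖ₑ ^ 2 < ⊤) → |∫ x, ⟪Literature.Analysis.FluidPDE.curl v x, fderiv ℝ v x (Literature.Analysis.FluidPDE.curl v x)⟫_ℝ| ≤ κ * M * Real.sqrt (∫ x, ‖Literature.Analysis.FluidPDE.curl v x‖ ^ 2) * Real.sqrt (∫ x, Literature.Analysis.FluidPDE.frobeniusNormSq (fderiv ℝ (Literature.Analysis.FluidPDE.curl v) x)))}) ^ 2 * M ^ 2 * ((∫ x, frobeniusNormSq (fderiv ℝ (curl v) x)) * (∫ x, θ x * ‖curl v x‖ ^ 2) 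+
        (∫ x, ‖curl v x‖ ^ 2) * (∫ x, θ x * frobeniusNormSq (fderiv ℝ (curl v) x))) ≤
      3 * (∫ x, ⟪curl v x, fderiv ℝ v x (curl v x)⟫) * (∫ x, θ x * ⟪curl v x, fderiv ℝ v x (curl v x)⟫) +
        (∫ x, ⟪curl v x, fderiv ℝ v x (curl v x)⟫) *
          (∫ x, (⟪cross (gradient θ x) (v x - c), fderiv ℝ v x (curl v x)⟫ +
            (fderiv ℝ θ x (curl v x)) * ⟪curl v x, v x - c⟫ + ⟪curl v x, fderiv ℝ v x (cross (gradient θ x) (v x - c))⟫)) -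
        (sInf {κ : ℝ | (∀ (v : EuclideanSpace ℝ (Fin 3) → EuclideanSpace ℝ (Fin 3)) (M B : ℝ), ContDiff ℝ (⊤ : ℕ∞) v → Literature.Analysis.FluidPDE.VectorCalculus.IsDivFree v → (∀ x, ‖v x‖ ≤ M) → (∀ x, ‖fderiv ℝ v x‖ ≤ B) → (∫⁻ x, ‖iteratedFDeriv ℝ 0 v x‖ₑ ^ 2 < ⊤) → (∫⁻ x, ‖iteratedFDeriv ℝ 1 v x‖ₑ ^ 2 < ⊤) → (∫⁻ x, ‖iteratedFDeriv ℝ 2 v x‖ₑ ^ 2 < ⊤) → |∫ x, ⟪Literature.Analysis.FluidPDE.curl v x, fderiv ℝ v x (Literature.Analysis.FluidPDE.curl v x)⟫_ℝ| ≤ κ * M * Real.sqrt (∫ x, ‖Literature.Analysis.FluidPDE.curl v x‖ ^ 2) * Real.sqrt (∫ x, Literature.Analysis.FluidPDE.frobeniusNormSq (fderiv ℝ (Literature.Analysis.FluidPDE.curl v) x)))}) ^ 2 * M ^ 2 * ((∫ x, frobeniusNormSq (fderiv ℝ (curl v) x)) * (∫ x, ⟪curl v x, cross (gradient θ x) (v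 x - c)⟫) +
          (∫ x, ‖curl v x‖ ^ 2) * (∫ x, ∑ i, ⟪fderiv ℝ (curl v) x (EuclideanSpace.basisFun (Fin 3) ℝ i),
            (fderiv ℝ θ x (EuclideanSpace.basisFun (Fin 3) ℝ i)) • curl v x +
              cross (fderiv ℝ (gradient θ) x (EuclideanSpace.basisFun (Fin 3) ℝ i)) (v x - c) +
              cross (gradient θ x) (fderiv ℝ v x (EuclideanSpace.basisFun (Fin 3) ℝ i))⟫)) -
        (∫ x, ⟪curl v x, fderiv ℝ v x (curl v x)⟫) *
          (∫ x, ⟪curl v x, fderiv ℝ (gradient (divPotential (fun y => θ y • (v y - c)))) x (curl v x)⟫) +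
        (sInf {κ : ℝ | (∀ (v : EuclideanSpace ℝ (Fin 3) → EuclideanSpace ℝ (Fin 3)) (M B : ℝ), ContDiff ℝ (⊤ : ℕ∞) v → Literature.Analysis.FluidPDE.VectorCalculus.IsDivFree v → (∀ x, ‖v x‖ ≤ M) → (∀ x, ‖fderiv ℝ v x‖ ≤ B) → (∫⁻ x, ‖iteratedFDeriv ℝ 0 v x‖ₑ ^ 2 < ⊤) → (∫⁻ x, ‖iteratedFDeriv ℝ 1 v x‖ₑ ^ 2 < ⊤) → (∫⁻ x, ‖iteratedFDeriv ℝ 2 v x‖ₑ ^ 2 < ⊤) → |∫ x, ⟪Literature.Analysis.FluidPDE.curl v x, fderiv ℝ v x (Literature.Analysis.FluidPDE.curl v x)⟫_ℝ| ≤ κ * M * Real.sqrt (∫ x, ‖Literature.Analysis.FluidPDE.curl v x‖ ^ 2) * Real.sqrt (∫ x, Literature.Analysis.FluidPDE.frobeniusNormSq (fderiv ℝ (Literature.Analysis.FluidPDE.curl v) x)))}) ^ 2 * M * (∫ x, ‖curl v x‖ ^ 2) * (∫ x, frobeniusNormSq (fderiv ℝ (curl v) x)) *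
          (A * R + Real.sqrt ((∫ x, VectorCalculus.divergence (fun y => θ y • (v y - c)) x ^ 2) / (4 * π * R))) := by
  have h := firstVariation_smul_ge_leray hv hdiv hMpos hM hcM hB h1 h2 hatt hθ hθc hθ01 hA hR
  rw [firstVar_stretching_smul hv hB h1 hθ hθc hθ01 c, firstVar_enstrophy_smul hv h1 hθ hθc hθ01 c,
    firstVar_palinstrophy_smul hv h2 hθ hθc hθ01 c] at h
  nlinarith [h]

end Expansion

end ExtremiserLiouville

end Summit.NavierStokesRegularity.NavierStokesRegularity.Theorems

end
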